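/-
Copyright (c) 2026 the pub-hodgecm-mathlib formalisation cell (harness21).  Prover seat hodgecm-mathlib-F0P2-p08 (g4) = KW DESK OF RECORD, Track B «K2-LIT»,
#184♮ = hLiu418 = `stmt-HodgeConjecture-24832`; socket #41 `sig_K2LiuSiegelEisensteinContinuation`, KIND W: THE WHOLE KW BLOCK AS ONE ★ NAME (books K2E5-plan (g8)
TABLE #16 §0 W3 NOTE, 2026-09-05T02:38Z; proof = K2E3-typ2 (g3)'s tie-probe v38 f8b2284fdbebb711 KW lines VERBATIM).  THEOREMS ONLY (no `def`, no `instance`, no notation,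
no named-fact hypothesis, no `sorry`).
-/
import Literature.NumberTheory.K2Lit.SiegelStandardIwasawaData
import Summits.HodgeConjecture.HodgeConjecture.Theorems.K2LiuKindWArchTypeOfRecord
import Summits.HodgeConjecture.HodgeConjecture.Theorems.K2LiuKindWBlockOfRecordCMOfLocalLettersHaar
import Summits.HodgeConjecture.HodgeConjecture.Theorems.K2LiuKindWFactorizationReadings
import Summits.HodgeConjecture.HodgeConjecture.Theorems.K2LiuKindWFactorLetters
import Summits.HodgeConjecture.HodgeConjecture.Theorems.K2LiuKindWArchLetterAtZero
import Summits.HodgeConjecture.HodgeConjecture.Theorems.K2LiuKindWFiniteLetterOfReading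
import Summits.HodgeConjecture.HodgeConjecture.Theorems.K2LiuKindWArchWhittakerHolomorphy
import Summits.HodgeConjecture.HodgeConjecture.Theorems.K2LiuHermTwoXiJetContinuation
import Summits.HodgeConjecture.HodgeConjecture.Theorems.K2LiuKindWArchHexOfDispatch
import Summits.HodgeConjecture.HodgeConjecture.Theorems.K2LiuKindWArchSizeFramesOfRecord
import Summits.HodgeConjecture.HodgeConjecture.Theorems.K2LiuKindWArchBlockLetterOfRecord
import Summits.HodgeConjecture.HodgeConjecture.Theorems.K2LiuKindWArchCarrierUniform
import Summits.HodgeConjecture.HodgeConjecture.Theorems.K2LiuKindWFactorLevelInvariance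
import Summits.HodgeConjecture.HodgeConjecture.Theorems.K2LiuKindWFiniteLevelAdapters
import Summits.HodgeConjecture.HodgeConjecture.Theorems.K2LiuKindWFiniteLettersOfRecord
import Summits.HodgeConjecture.HodgeConjecture.Theorems.K2LiuKindWFiniteStabilityLettersOfReading
import Summits.HodgeConjecture.HodgeConjecture.Theorems.K2LiuKindWFiniteRadiusStability
import Summits.HodgeConjecture.HodgeConjecture.Theorems.K2LiuSkewLatticeShells
import Summits.HodgeConjecture.HodgeConjecture.Theorems.K2LiuKindWFiniteSectionSupBoundBad
import Summits.HodgeConjecture.HodgeConjecture.Theorems.K2LiuKindWArchLetterIntegrableBridge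
import HarnessLib
import HarnessLib

/-!
# Crux `HLiu418`, socket #41, KIND W — `K2LiuKindWBlockByName`: THE 13-SLOT KIND-W BLOCK OF ★ `kindW_block_cm_of_localLetters_haar` WITH ALL 55 ∀-LETTERS
# DISCHARGED BY NAME — one theorem over the socket's own scope (transported standard pair), so the socket edition's KW block is ONE `obtain`

Cell `hodgecm-mathlib`, crux item hLiu418 = `stmt-HodgeConjecture-24832` (helper lane `--supports … --as helper`, count-neutral), route of record `HCCMUnconditional`;
squad K2 ∕ K2Liu, road `K2_Liu`, socket #41, KIND W; KW desk of record F0P2-p08 (g4); recipe card v5 `KW-TIE-RECIPE.v5.F0P2-p08-g4.md` (34019b3147f2b249).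
THE POINT.  K2E3-typ2 (g3)'s tie-probe v38 certifies that the 55 ∀-letters of ★ p863724 `K2LiuKindWBlockOfRecordCMOfLocalLettersHaar.kindW_block_cm_of_localLetters_haar` are
ALL payable by ★ names (KW desk recipe Steps 0–4f), but the 55-letter application needs probe-local `maxHeartbeats 4 000 000` while the socket file runs at 1 600 000
(books K2E5-plan (g8) TABLE #16 §0 W3 NOTE).  THIS FILE packages the whole recipe ONCE:
* **`kindW_block_by_name`** — inputs: ONLY the socket's scope at a transported standard pair — the CM frame `(L e dV hdV hdV0 dW hdW hdW0)`, the conjugate-symplectic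
  `lam` with `HasWeight L lam 1`, a STANDARD Iwasawa datum `𝒦'` (`𝒦'.IsStd`), a standard section family `f'` (`IsStandardSectionFamily 𝒦' (toHeckeCharacter L lam⁻¹) f'`,
  `∀ s, Continuous (f' s)`), and a Haar measure `νN` on `N_Δ(𝔸)` ⊢ ★ p863724's 13-slot conclusion VERBATIM (`∃ A U, hEuler ∧ hAd ∧ ∃ τ NW, hτ ∧ hdec ∧ ∃ CW κ, hCW ∧ hκ ∧ hsupp`).
  Proof = tie-probe v38 :229 + :243–:341 VERBATIM: Step 0 ★ p863824 arch type of record; Step 1 ★ p863597 (KW-fac) readings at `s₀ := 2`; Step 2 ★ p863724 carriers∕head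
  (`Tx := S₀`); Step 3 junction; Step 4a `hint` ★ p863446 ∘ ★ p863520; 4b `Finf` guarded reading + ★ p863494 with `hex` ★ p863879 (`hWhol` ★ p864042, `hInd` ★ p864106);
  4c `Ffin` guarded reading + ★ p863658 with `hsd` ★ p864184; 4e (iii-fin) ★ p863964 → ★ p864220 → (R) ★ p864500 → (B) ★ p864515 → ★ p864127; 4f (iii-arch) frames
  ★ p863892 + `hBL` ★ p864537 (with `hν` ★ p864253); Step 5 `@hKW` on 55 names.  The archimedean∕local carriers' Borel structures are `borel _` INSIDE (the conclusion
  only mentions `νN`); `DecidableEq` by `classical`.  Heartbeats MEASURED in-file.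
CONSUMERS: kit K2Liu-plan (g5) ED. 13 of the socket file (`obtain ⟨A, U, hEuler, hAd, τ, NW, hτ, hdec, CW, κ, hCW, hκ, hsupp⟩ := kindW_block_by_name …`), K2E3-typ2 (g3) #41
v39+, K2E3-typ4 (g3) #42S (same name at its class datum).
CREDIT (the ★ payers composed here, 14 hands): K2E4-p10 (head, arch type, K-uniformity, G5), K2E3-p26 ((KW-fac) readings, levels, package, (B) head), F0P2-p08 g3
(readings∕letters∕frames), LH4-p10 (`hWhol`, explicit chain, height, G6), K2E4-p11 (organ «Φ6b-ind»), K2Liu-p11 (`hex`, conversion, assembler, `hBL_of_record`), K2E3-p37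
(`hsd`, 2b, conductor), K2Liu-p13 ((ι)(ι′)), K2E3-p06 ((R) chain + closed head), F0P2-p09 (twin∕radii∕place functions), K2E3-p29 (FILE 3), K2E3-p03 ((B) FILE 1),
K2Liu-p26 ((V), (3a′)), K2E3-p11 (dispatch, (3b), `hWgrU`, Stab-uniformization), LH4-p08 (letters∕growth∕at-one heads).
[cite: KudlaRallis1994, §1–§2] [cite: Tan1999, §2–§4] [cite: Shimura1982, §3 Thm. 3.1, §4 Thm. 4.2] [cite: Shimura1997, §16.4, §18.4 Prop. 18.14, §19]
[cite: MoeglinWaldspurger1995, II.1.5–II.1.7, IV.1.9] [cite: CasselsFrohlichANT1967, Ch. XV (Tate) §3.3] [cite: BorelJacquet1979, §4.1]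
HONEST LABEL.  Count-neutral helper; closes no socket by itself: `HC_CM` is proved only modulo the 7 printed citations (2 remaining named inputs:
hLiu418 = `stmt-HodgeConjecture-24832`, h413 = `stmt-HodgeConjecture-24833`) until rung 0 closes.
-/

set_option autoImplicit false
set_option linter.dupNamespace false -- the mandated namespace repeats `HodgeConjecture.HodgeConjecture`

noncomputable section

open scoped Matrix BigOperators NNReal ENNReal ComplexConjugate RestrictedProduct Topology
open scoped Classical
open NumberField NumberField.InfinitePlace IsDedekindDomain MeasureTheory Measure
open Literature.NumberTheory.Automorphic Literature.NumberTheory.GaloisRepresentations Literature.NumberTheory.LFunctions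
open Literature.NumberTheory.Automorphic.UnitaryGroup (archAt archPart archLocal)
open Literature.NumberTheory.GelbartRogawski1991 Literature.NumberTheory.GelbartRogawski1991.GRConstruction
open Literature.NumberTheory.GelbartRogawski1991.UnitaryDualPair (complexConj_imagUnit imagUnit_ne_zero imagUnit_mul_self)
open Literature.NumberTheory.K2Lit.SiegelDoubled Literature.NumberTheory.K2Lit.PlaceSplitting
open Literature.MeasureTheory.RestrictedProduct
open Literature.Topology.Algebra.RestrictedProduct (inH)
open Literature.NumberTheory.Automorphic.IdeleClassGroup (toHeckeCharacter isUnitary_toHeckeCharacter IsConjugateSymplectic HasWeight)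
open Summit.HodgeConjecture.HodgeConjecture.Cruxes.HLiu418.K2LiuSiegelUnipotentLocalDefs
open Summit.HodgeConjecture.HodgeConjecture.Cruxes.HLiu418.K2LiuSiegelUnipotentSplitAtDefs
open Summit.HodgeConjecture.HodgeConjecture.Cruxes.HLiu418.K2LiuSiegelUnipotentFourierDefs
open Summit.HodgeConjecture.HodgeConjecture.Cruxes.HLiu418.K2LiuSiegelEisensteinKindWLetters (kindWPlaces kindWFinset)

namespace Summit.HodgeConjecture.HodgeConjecture.Cruxes.HLiu418.K2LiuKindWBlockByName

open Summit.HodgeConjecture.HodgeConjecture.Cruxes.HLiu418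

set_option maxHeartbeats 4000000 in -- MEASURED: 2 000 000 ✗ (deterministic timeout at `whnf` — the 55-letter `@hKW` application, as in tie-probe v38); 4 000 000 ✓ (225 s remote). Statement-telescope class of ★ p863724∕p864092.
/-- **THE 13-SLOT KIND-W BLOCK OF SOCKET #41 BY NAME** (see the module docstring): for a transported STANDARD pair `(𝒦', f')` under the conjugate-symplectic weight-one `lam`
and a Haar `νN` on `N_Δ(𝔸)`, ★ p863724's KW conclusion holds — every one of its 55 ∀-letters is a ★ name (KW desk recipe Steps 0–4f, tie-probe v38 VERBATIM).
[cite: KudlaRallis1994, §1–§2] [cite: Tan1999, §2–§3, §4 Prop. 4.8] [cite: Shimura1982, §3] [cite: Shimura1997, §18.4 Prop. 18.14, §19] [cite: CasselsFrohlichANT1967, Ch. XV (Tate) §3.3]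
[cite: MoeglinWaldspurger1995, II.1.7, IV.1.9] -/
theorem kindW_block_by_name
    (L : Type) [Field L] [NumberField L] [IsCMField L] {n : ℕ} (e : Fin 2 × Fin 1 ≃ Fin n)
    (dV : Fin 2 → L) (hdV : ∀ i, IsCMField.complexConj L (dV i) = dV i) (hdV0 : ∀ i, dV i ≠ 0)
    (dW : Fin 1 → L) (hdW : ∀ i, IsCMField.complexConj L (dW i) = dW i) (hdW0 : ∀ i, dW i ≠ 0)
    (lam : IdeleClassGroup L →ₜ* Circle) (hlam : IsConjugateSymplectic L lam)
    (𝒦 : IwasawaDatum L e dV hdV dW hdW) (f : ℂ → HA L e dV hdV dW hdW → ℂ)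
    (hstd : IsStandardSectionFamily 𝒦 (toHeckeCharacter L lam⁻¹) f) (hcont : ∀ s, Continuous (f s))
    [MeasurableSpace (unipDelta L e dV hdV dW hdW)] [BorelSpace (unipDelta L e dV hdV dW hdW)]
    (νN : Measure (unipDelta L e dV hdV dW hdW)) [νN.IsHaarMeasure]
    (hwt : HasWeight L lam 1) (h𝒦 : 𝒦.IsStd) :
    ∃ (A : skewMatrices ((IsCMField.complexConj L : L ≃ₐ[Fp L] L) : L →+* L) ((gramR L e dV hdV dW hdW).map (algebraMap (Fp L) L)) → ℂ → HA L e dV hdV dW hdW → ℂ)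
      (U : skewMatrices ((IsCMField.complexConj L : L ≃ₐ[Fp L] L) : L →+* L) ((gramR L e dV hdV dW hdW).map (algebraMap (Fp L) L)) → HA L e dV hdV dW hdW →
        Set (HeightOneSpectrum (𝓞 ↥(maximalRealSubfield L)))),
      (∀ S : skewMatrices ((IsCMField.complexConj L : L ≃ₐ[Fp L] L) : L →+* L) ((gramR L e dV hdV dW hdW).map (algebraMap (Fp L) L)),
        (S : Matrix (Fin n) (Fin n) L).det ≠ 0 → ∀ (s : ℂ) (h : HA L e dV hdV dW hdW), (n : ℝ) / 2 < s.re →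
          whittakerDelta L e dV hdV dW hdW νN (S : Matrix (Fin n) (Fin n) L) (f s) h =
            A S s h * (partialStandardL (U S h) (fun _ => {1}) (2 * s + 1) *
              partialStandardL (U S h) (fun v => {(quadraticHeckeCharCM L).valueAtUniformizer v}) (2 * s + 2))⁻¹) ∧
      (∀ S (h : HA L e dV hdV dW hdW), DifferentiableOn ℂ (fun s => A S s h) {s : ℂ | 0 < s.re}) ∧
      ∃ (τ : skewMatrices ((IsCMField.complexConj L : L ≃ₐ[Fp L] L) : L →+* L) ((gramR L e dV hdV dW hdW).map (algebraMap (Fp L) L)) → ℝ) (NW : ℕ),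
        (∀ S : skewMatrices ((IsCMField.complexConj L : L ≃ₐ[Fp L] L) : L →+* L) ((gramR L e dV hdV dW hdW).map (algebraMap (Fp L) L)),
          ‖(fun i j => NumberField.mixedEmbedding L ((S : Matrix (Fin n) (Fin n) L) i j))‖ ≤ τ S) ∧
        (∀ z : ℂ, 0 < z.re → ∃ C a c a' r : ℝ, 0 ≤ C ∧ 0 ≤ a ∧ 0 < c ∧ 0 ≤ a' ∧ 0 < r ∧ ∀ S (s : ℂ), dist s z < r → ∀ h : HA L e dV hdV dW hdW,
          ‖A S s h‖ ≤ C * adelicHeightGL (n + n) L (h : GL (Fin (n + n)) (AdeleRing (𝓞 L) L)) ^ a *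
            (Real.exp (-(c * adelicHeightGL (n + n) L (h : GL (Fin (n + n)) (AdeleRing (𝓞 L) L)) ^ (-a') * τ S)) * (1 + τ S) ^ NW)) ∧
        ∃ CW κ : ℝ, 0 < CW ∧ 0 ≤ κ ∧
          ∀ S (s : ℂ) (h : HA L e dV hdV dW hdW), 0 < s.re → A S s h ≠ 0 →
            ∃ D : ℕ, 1 ≤ D ∧ (D : ℝ) ≤ CW * adelicHeightGL (n + n) L (h : GL (Fin (n + n)) (AdeleRing (𝓞 L) L)) ^ κ ∧
              ∀ i j, IsIntegral ℤ ((D : L) * (S : Matrix (Fin n) (Fin n) L) i j) := by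
  classical
  -- FRAME: `n = 2` is forced by `e : Fin 2 × Fin 1 ≃ Fin n`; make it literal (every payer is stated at `e : Fin N × Fin M ≃ Fin 2`)
  obtain rfl : n = 2 := by
    have h2 : Fintype.card (Fin 2 × Fin 1) = Fintype.card (Fin n) := Fintype.card_congr e
    simp only [Fintype.card_prod, Fintype.card_fin] at h2
    omega
  -- Step 0: the archimedean type OF RECORD of `toHeckeCharacter L lam⁻¹` (★ p863824, K2E4-p10 (g10)): `ht`, `t w = ±1`, the (G4) window `hk`
  obtain ⟨t, ht, ht1, hk⟩ := K2LiuKindWArchTypeOfRecord.exists_archType_of_hasWeight_one L lam hwt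
  letI : MeasurableSpace (K2LiuSiegelUnipotentLocalDefs.unipDeltaArch L e dV hdV dW hdW) := borel _
  haveI : BorelSpace (K2LiuSiegelUnipotentLocalDefs.unipDeltaArch L e dV hdV dW hdW) := ⟨rfl⟩
  letI : ∀ v : HeightOneSpectrum (𝓞 (Fp L)), MeasurableSpace (K2LiuSiegelUnipotentLocalDefs.unipDeltaLoc L e dV hdV dW hdW v) := fun v => borel _
  haveI : ∀ v : HeightOneSpectrum (𝓞 (Fp L)), BorelSpace (K2LiuSiegelUnipotentLocalDefs.unipDeltaLoc L e dV hdV dW hdW v) := fun v => ⟨rfl⟩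
  -- ===== KW TIE RECIPE (desk card c439a7e6) Step 0: the character letters =====
  have hχu : (toHeckeCharacter L lam⁻¹).IsUnitary := Literature.NumberTheory.Automorphic.IdeleClassGroup.isUnitary_toHeckeCharacter L lam⁻¹
  -- Step 1: the (KW-fac) READINGS ★ p863597 at the transported standard pair `(𝒦, f')` and the abscissa `s₀ := 2` (any abscissa types; the desk may word another)
  obtain ⟨S₀, hχS₀, mW, bW, AW, hb₀, hb, hfinW, hAcW, hAlaw, fT, FinfT, FvT, hfT, hreadArch, hread, hjun⟩ :=
    K2LiuKindWFactorizationReadings.exists_kindW_factorization_readings L e dV hdV dW hdW hdV0 hdW0 h𝒦 hstd hcont (2 : ℂ)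
  -- Step 2: carriers with Haar `νinf` and `S₀ ⊆ T₀` EXPORTED — K2E4-p10 (g10) FILE 2 `kindW_block_cm_of_localLetters_haar … (Tx := S₀)`
  obtain ⟨T₀, νv, hνh, hνσ, νinf, hνinfH, hνinfσ, hS₀T₀, hνK, hmap, hT₀, hKW⟩ :=
    K2LiuKindWBlockOfRecordCMOfLocalLettersHaar.kindW_block_cm_of_localLetters_haar L e dV hdV hdV0 dW hdW hdW0 lam hlam 𝒦 f hstd hcont νN S₀
  haveI := hνh
  haveI := hνσ
  -- «KW-car-Haar» (audit1 (g3) 00:24:45Z (d)): the archimedean carrier IS Haar — the instance ★ `hint_of_factorIntegrable` ∘ ★ `hintArch_of_std` need for the `hint` slot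
  haveI : ∀ T', (νinf T').IsHaarMeasure := hνinfH
  -- the head's 55 ∀-letters = THE KW SLOTS, all by value:
  --   Σ⊗ ∕ continuation letters (14): {fT} hfac {m} FinfT FvT hsum hint Finf Ffin hFinfI hFfinI hFinf hFfin hFinf0
  --   (iii-fin) per-place level∕size letters (14): lev Tδ₀ δ₀ hδ₀ k hlev Tc c hc hsuppLoc k₂ k₃ Tβ hsizeLoc
  --   (iii-arch) frames + block letter (27): {Sinf} [Fintype Sinf] φ A B Ainv Binv {Mf} hMf hA hB hAe hBe hAi hBi hcover w hw er T Tinv hT {M} hM hTe hTe' hBL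
  -- Step 3: the junction at `T₀ ⊇ S₀` (exported by the `_haar (Tx := S₀)` head)
  obtain ⟨hfac, hsum⟩ := hjun T₀ hS₀T₀
  -- Step 4a: `hint` BY NAME = ★ p863446 `hint_joint_of_reading` ∘ ★ p863520 `hintArch_of_std` (inputs: readings' `hAlaw hfinW hAcW hreadArch` + `ht` (v17) + Haar `νinf`)
  have hintArch := K2LiuKindWArchLetterIntegrableBridge.hintArch_of_std L e dV hdV dW hdW hdV0 hdW0 ht 𝒦 h𝒦 (2 : ℂ) AW hAlaw hfinW hAcW T₀ νinf FinfT hreadArch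
  have hint := K2LiuKindWFactorLetters.hint_joint_of_reading L e dV hdV dW hdW hdV0 hdW0 T₀ νinf νv hχu 𝒦 (2 : ℂ) hχS₀ FinfT bW hb (FvT T₀) (hread T₀) hintArch
  -- Step 4b: `Finf` := the archimedean letter OF RECORD (zero at singular `S`, else ★ `K2LiuKindWArchLetterDefs.kindWArchLetter`), introduced OPAQUELY with its reading equation
  obtain ⟨FinfW, hFinfW⟩ : ∃ FinfW : Fin mW → K2LiuSiegelUnipotentFourierDefs.skewMatrices ((IsCMField.complexConj L : L ≃ₐ[Fp L] L) : L →+* L) ((gramR L e dV hdV dW hdW).map (algebraMap (Fp L) L)) → ℂ → HA L e dV hdV dW hdW → ℂ,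
      ∀ j S s h, FinfW j S s h = if (S : Matrix (Fin 2) (Fin 2) L).det = 0 then 0 else K2LiuKindWArchLetterDefs.kindWArchLetter L e dV hdV dW hdW νinf T₀ FinfT j S s h :=
    ⟨fun j S s h => if (S : Matrix (Fin 2) (Fin 2) L).det = 0 then 0 else K2LiuKindWArchLetterDefs.kindWArchLetter L e dV hdV dW hdW νinf T₀ FinfT j S s h, fun _ _ _ _ => rfl⟩
  -- `hFinf` ∕ `hFinf0` ★ p863494 by the reading (no residue); `hFinfI` ★ p863494 UNDER the per-`(j,S,h)` existence letter `hex` — ONE slot at the payer INPUT (⇐ ★ p863572 `K2LiuKindWArchContinuationBridge.hex_of_sumPresentation` ∘ ⏳ p863629 `K2LiuKindWArchContinuationOfRecord` (LH4-p10) modulo `heb` (K2Liu-p11) ∕ `hW` (LH4-p08 ∕ «Φ6b-ind» (R4)))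
  have hFinf := K2LiuKindWArchLetterAtZero.hFinf_of_reading L e dV hdV dW hdW (νinf := νinf) (T₀ := T₀) (FinfT := FinfT) (Finf := FinfW) (hread := hFinfW)
  have hFinf0 := K2LiuKindWArchLetterAtZero.hFinf0_of_reading L e dV hdV dW hdW (νinf := νinf) (T₀ := T₀) (FinfT := FinfT) (Finf := FinfW) (hread := hFinfW)
  -- (v35) `hex` BY NAME AND CLOSED: ★ `K2LiuKindWArchHexOfDispatch.hex_of_dispatch` at the type `t` OF RECORD (★ p863824), `s₀ := 2`, the readings' arch data, `T₀`, Haar `νinf`; `hk` := ★ p863824 4th component, `hWhol` := ★ p864042 `hWhol_of_std` (v33 lambda at `k w := -(t w.1)`), `hInd` := ★ p864106 `exists_twistedWhittaker_continuation_of_indef'` — NO residue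
  have hexW := K2LiuKindWArchHexOfDispatch.hex_of_dispatch L e dV hdV dW hdW hdV0 hdW0 ht
    hk
    𝒦 h𝒦 (2 : ℂ) AW hAlaw hfinW hAcW FinfT hreadArch T₀ νinf
    (fun B C Pt hidx eb hx hPt hherm hebr => K2LiuKindWArchWhittakerHolomorphy.hWhol_of_std (fun S : K2LiuSiegelUnipotentFourierDefs.skewMatrices ((IsCMField.complexConj L : L ≃ₐ[Fp L] L) : L →+* L) ((gramR L e dV hdV dW hdW).map (algebraMap (Fp L) L)) => (S : Matrix (Fin 2) (Fin 2) L).det ≠ 0)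
      (fun w : {w : InfinitePlace L // w.IsComplex} => -(t w.1)) B C hx Pt hPt eb hidx hherm hebr (((2 : ℕ) : ℝ) / 2) (by norm_num))
    K2LiuHermTwoXiJetContinuation.exists_twistedWhittaker_continuation_of_indef'
  have hFinfI := K2LiuKindWArchLetterAtZero.hFinfI_of_reading L e dV hdV dW hdW (νinf := νinf) (T₀ := T₀) (FinfT := FinfT) (Finf := FinfW) (hread := hFinfW) (hex := hexW)
  -- Step 4c (v30): `Ffin` := the finite letter OF RECORD at the det-GUARDED reading (★ p863658 ED. 2 §3: `0` at singular `S`, else ★ `kindWFfin` at the uniformisers of record), introduced OPAQUELY with its reading equation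
  obtain ⟨FfinW, hFfinW⟩ : ∃ FfinW : Fin mW → K2LiuSiegelUnipotentFourierDefs.skewMatrices ((IsCMField.complexConj L : L ≃ₐ[Fp L] L) : L →+* L) ((gramR L e dV hdV dW hdW).map (algebraMap (Fp L) L)) → HA L e dV hdV dW hdW → HeightOneSpectrum (𝓞 (Fp L)) → ℂ → ℂ,
      ∀ j S h v s, FfinW j S h v s = if (S : Matrix (Fin 2) (Fin 2) L).det = 0 then 0 else K2LiuKindWFiniteLetterDefs.kindWFfin L e dV hdV dW hdW T₀ νv (fun v => (HeckeCharacter.uniformizer (Fp L) v : v.adicCompletion (Fp L))) (FvT T₀) j S h v s :=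
    ⟨fun j S h v s => if (S : Matrix (Fin 2) (Fin 2) L).det = 0 then 0 else K2LiuKindWFiniteLetterDefs.kindWFfin L e dV hdV dW hdW T₀ νv (fun v => (HeckeCharacter.uniformizer (Fp L) v : v.adicCompletion (Fp L))) (FvT T₀) j S h v s, fun _ _ _ _ _ => rfl⟩
  -- `hFfinI` ★ p863658 §3 `hFfinI_of_reading'` (no residue); `hFfin` ★ p863658 §3 `hFfin_of_reading'` with its det-guarded Φ5 letters `hsd` PAID BY NAME (v34): ★ p864184 `K2LiuKindWFiniteStabilityLettersOfReading.hsd_of_isStd_of_det_ne_zero … h𝒦` (K2E3-p37 (g3)) at the transported STANDARD datum `𝒦` over the (KW-fac) reading of record — no residue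
  have hFfinI := K2LiuKindWFiniteLetterOfReading.hFfinI_of_reading' L e dV hdV dW hdW (hdV0 := hdV0) (hdW0 := hdW0) (T₀ := T₀) (νv := νv) (hχu := hχu) (𝒦 := 𝒦) (s₀ := (2 : ℂ)) (hχS₀ := hχS₀) (b := bW) (hb := hb) (FvT := FvT T₀) (hread := hread T₀) (Ffin' := FfinW) (hreadF' := hFfinW)
  have hFfin := K2LiuKindWFiniteLetterOfReading.hFfin_of_reading' L e dV hdV dW hdW (T₀ := T₀) (νv := νv) (FvT := FvT T₀) (Ffin' := FfinW) (hreadF' := hFfinW)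
    (hsd := K2LiuKindWFiniteStabilityLettersOfReading.hsd_of_isStd_of_det_ne_zero L e dV hdV dW hdW hdV0 hdW0 T₀ νv 𝒦 (2 : ℂ) hχS₀ bW hb (FvT T₀) (hread T₀) h𝒦)
  -- Step 4e (v36): THE (iii-fin) GROUP BY THE THREE OBTAINS OF RECORD (KW desk card v4 §(iii-fin)): level of the reading → (ι′) level letters → the packaged letters of record
  --   (1) ★ p863964 §3 `exists_levels_forall_FvT_mul_eq` (K2E3-p26 (g3)): the principal LEVEL `(cL, hlevInv)` (vanishing off `TcL`) of the (KW-fac) reading at the transported STANDARD datum `𝒦`, abscissa `2`, its `hb₀`, and the uniformisers `ϖ_w := HeckeCharacter.uniformizer L w` of record of the places of `L`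
  obtain ⟨TcL, cL, hcL, hlevInv⟩ := K2LiuKindWFactorLevelInvariance.exists_levels_forall_FvT_mul_eq L e dV hdV hdV0 dW hdW hdW0 h𝒦 (2 : ℂ) hχS₀ bW hb₀ (FvT T₀) (hread T₀)
    (fun w => (HeckeCharacter.uniformizer L w : w.adicCompletion L)) (fun w => HeckeCharacter.valued_uniformizer (K := L) w)
  --   (2) ★ p864220 `K2LiuKindWFiniteLevelAdapters.exists_levelLetters'` (K2Liu-p13 (g5), (ι′) = ★ p864124 (ι) + the sixth reading `hAlev`): the height exponents `AL`, the ball exponents `a₀`, the SHARED level data `lev Tδ₀ δ₀ k` with (A) `hAL`, (δ) `hδ₀`, `hlev`, (dom) `ha₀`, (ball) `hball`, (Alev) `hAlev` (for the (R) payer) — at the uniformisers of record `π_v` of `L⁺` and `ϖ_w` of `L`, over the level `(TcL, cL, hcL)`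
  obtain ⟨AL, a₀, lev, Tδ₀, δ₀, k, hAL, hδ₀, hlev, ha₀, hball, hAlev⟩ := K2LiuKindWFiniteLevelAdapters.exists_levelLetters' L e dV hdV dW hdW hdV0 hdW0
    (fun v => (HeckeCharacter.uniformizer (Fp L) v : v.adicCompletion (Fp L))) (fun v => HeckeCharacter.valued_uniformizer (K := Fp L) v)
    (fun w => (HeckeCharacter.uniformizer L w : w.adicCompletion L)) (fun w => HeckeCharacter.valued_uniformizer (K := L) w) TcL cL hcL
  --   (3) ★ p864127 `K2LiuKindWFiniteLettersOfRecord.kindW_finite_letters_of_record` (K2E3-p26 (g3)): slots `Tc c hc hsuppLoc k₂ k₃ Tβ hsizeLoc` — (V) ★ p864002 `hvol_of_haar` (from `hνK`), (θ) ★ `exists_conductorLetters`, (ζ) ★ p863825, `hFinv` §1, ★ p863876 `hsuppLoc_of_level_guarded`, ★ p863720 `hsizeLoc_of_place` ALL INSIDE; BY VALUE: (R) `Tρ ρ hρ a₁ a₂ a₃ hstab` (radius-stability of the ball integrals; K2E3-p06∕K2E3-p03 per LEAD) + (B) `b₁ Tβ hsup` (the sup letter on the balls) = 10 letters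
  --   (3R) (v38) THE (R) LETTERS BY NAME: ★ p864500 `K2LiuKindWFiniteRadiusStability.hstab_of_level_conductor` (K2E3-p06 (g7)) at the level `M h w := cL w + 2·AL h w` of the reading — `hf` := ★ `kindWFvT_mem_localDegPS` (the factors lie in `I_v(s, χ_v)`, ALL `s`), `hfc` := ★ p864184 `level_and_holomorphy_letters_of_isStd` (.1: ONE open level for every `s`) ∘ ★ `continuous_of_rightInvariant` (K2E3-p06 census 02:22:33Z, certified 36dd3e1f6ca248a7),
  --        `hMinv` := ★ p863964 §4 `FvT_mul_mul_evalPlace_eq` at `a := AL h` (heights (A) `hAL`), `hMlev` := (ι′)'s sixth reading `hAlev` at `v := w ∩ L⁺`, `hMK` := ★ `K2LiuKindWFiniteLevelAdapters.hMK_of_hA cL AL hAL`; instance `(νv v).IsHaarMeasure` from `hνh`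
  obtain ⟨Tρ, ρ, a₁, a₂, a₃, hρ, hstab⟩ :=
    K2LiuKindWFiniteRadiusStability.hstab_of_level_conductor L e dV hdV dW hdW hdV0 hdW0 T₀ νv
      (fun v => HeckeCharacter.valued_uniformizer (K := Fp L) v) (FvT T₀) (toHeckeCharacter L lam⁻¹)
      (fun j S h v s _ => ((Literature.NumberTheory.K2Lit.LocalSiegelDoubled.mem_localDegPS_iff (Fp L) L (IsCMField.complexConj L) (complexConj_imagUnit L) (imagUnit_ne_zero L) (imagUnit_mul_self L) v.1 2
          (gramR_isSymm L e dV hdV dW hdW) (hermD_eq_map_gramD L e dV hdV dW hdW) _ s _).1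
        (K2LiuKindWFactorLetters.kindWFvT_mem_localDegPS L e dV hdV dW hdW 𝒦 (2 : ℂ) hχS₀ bW hb (FvT T₀) (hread T₀) j S h v s)).1)
      (fun j S h v s _ => by
        obtain ⟨⟨U, hU, hfU⟩, -⟩ := K2LiuKindWFiniteStabilityLettersOfReading.level_and_holomorphy_letters_of_isStd L e dV hdV dW hdW hdV0 hdW0 T₀ 𝒦 (2 : ℂ) hχS₀ bW hb (FvT T₀) (hread T₀) h𝒦 j S h v
        exact K2LiuSkewLatticeShells.continuous_of_rightInvariant hU (hfU s))
      (fun w => (HeckeCharacter.uniformizer L w : w.adicCompletion L)) (fun w => HeckeCharacter.valued_uniformizer (K := L) w)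
      (fun h w => cL w + 2 * AL h w)
      (fun j S h v s y k hk => K2LiuKindWFactorLevelInvariance.FvT_mul_mul_evalPlace_eq L e dV hdV dW hdW (FvT T₀)
        (fun w => (HeckeCharacter.uniformizer L w : w.adicCompletion L)) (fun w => HeckeCharacter.valued_uniformizer (K := L) w) cL hlevInv j S h v s h
        (fun w => AL h w.1) (fun w => hAL h w.1) y k hk)
      lev (fun h w => hAlev h (w.under (𝓞 (Fp L))) ⟨w, rfl⟩)
      (K2LiuKindWFiniteLevelAdapters.hMK_of_hA L e dV hdV dW hdW cL AL hAL)
  --   (3B) (v38) THE (B) LETTERS BY NAME: ★ p864515 `K2LiuKindWFiniteSectionSupBoundBad.hsup_of_height` (K2E3-p26 (g3)) = ★ p864372 `hsup_of_height_of_bad` (K2E3-p03 (g10); off `S₀` the unramified `Λ_{s,v}`; `b₁ := 0`, `Tβ := Tb ∪ {w ∣ 2}`) ∘ `hbad_of_std` (on `S₀`), over the (KW-fac) reading at the transported STANDARD datum `𝒦`, `π_v` of record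
  obtain ⟨b₁, Tβ, hsup⟩ := K2LiuKindWFiniteSectionSupBoundBad.hsup_of_height L e dV hdV hdV0 dW hdW hdW0 T₀ hχu hχS₀ h𝒦 (2 : ℂ) bW hb (FvT T₀) (hread T₀)
    (fun v => (HeckeCharacter.uniformizer (Fp L) v : v.adicCompletion (Fp L)))
  obtain ⟨Tc, c, hc, hsuppLoc, k₂, k₃, Tβ', hsizeLoc⟩ :=
    K2LiuKindWFiniteLettersOfRecord.kindW_finite_letters_of_record L e dV hdV hdV0 dW hdW hdW0 T₀ νv hνh
      (fun v => HeckeCharacter.valued_uniformizer (K := Fp L) v) (FvT T₀) FfinW hFfinW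
      (fun w => (HeckeCharacter.uniformizer L w : w.adicCompletion L)) (fun w => HeckeCharacter.valued_uniformizer (K := L) w) cL hlevInv
      AL a₀ lev Tδ₀ δ₀ hδ₀ k hlev hAL ha₀ hball hνK
      Tρ ρ hρ a₁ a₂ a₃ hstab
      b₁ Tβ hsup
  -- Step 4f (v31): THE (iii-arch) SIZE FRAMES OF RECORD, ∃-road (★ p863892 ED. 2; no threading with the (x-a) column's frames): 26 of the 27 (iii-arch) letters BY NAME at `Sinf := {w ∕∕ w.IsComplex}`, `φ σ := σ.1.embedding`, `w := id`, `er := e₂ (n := 2)`; by value: `hBL` = ORGAN «Φ6b-ind» (R3) growth letter (K2E4-p11)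
  obtain ⟨Tfr, Tinv, Aι, Bι, Aιinv, Bιinv, Mf, Mι, hTdef, hTinvdef, hAιdef, hBιdef, hMf, hAι, hBι, hAe, hBe, hAi, hBi, hcover, hwι, hTι, hMι, hTe, hTe'⟩ :=
    K2LiuKindWArchSizeFramesOfRecord.exists_archSizeFrames_of_record L e dV hdV dW hdW hdV0 hdW0
  -- the head's 55 ∀-letters: 54 BY NAME (continuation group 14 with residual INPUTS NONE (`hk`∕`hInd` v35, `hWhol` v33, `hsd` v34 BY NAME); (iii-fin) group 14 BY THE THREE OBTAINS OF RECORD, (R) ★ p864500 and (B) ★ p864515 BY NAME — NO residual input (v38); (iii-arch) 26 size-frame letters + `hBL` ★ p864537 BY NAME) — 55∕55, NOTHING by value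
  --   (iii-arch) frames + block letter (27): {Sinf} [Fintype Sinf] φ A B Ainv Binv {Mf} hMf hA hB hAe hBe hAi hBi hcover w hw er T Tinv hT {M} hM hTe hTe' hBL
  obtain ⟨A, U, hEuler, hAd, τ, NW, hτ, hdec, CW, κ, hCW, hκ, hsupp⟩ := @hKW
    fT hfac mW FinfT (FvT T₀) hsum hint FinfW FfinW hFinfI hFfinI hFinf hFfin hFinf0
    lev Tδ₀ δ₀ hδ₀ k hlev Tc c hc hsuppLoc k₂ k₃ Tβ' hsizeLoc
    {w : InfinitePlace L // w.IsComplex} _ (fun σ => σ.1.embedding) Aι Bι Aιinv Bιinv Mf hMf hAι hBι hAe hBe hAi hBi hcover (fun σ => σ) hwι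
    (Literature.NumberTheory.GelbartRogawski1991.GRConstruction.e₂ (n := 2)) Tfr Tinv hTι Mι hMι hTe hTe'
    -- (v38) `hBL` BY NAME: ★ p864537 `K2LiuKindWArchBlockLetterOfRecord.hBL_of_record` (K2Liu-p11 (g5); CLOSED head — `hWhol hPosU hNegU hIndU` inside) at the type `t` of record (`ht hk` ★ p863824), the (KW-fac)∕(x-a) letters, Haar `νinf` (instance `hνinfH`), the carrier uniformity ★ p864253 `νinf_eq_of_factorisation` (from `hνσ hνK hmap`), the frames of record BY VALUE, the guarded reading `hFinfW`
    (K2LiuKindWArchBlockLetterOfRecord.hBL_of_record L e dV hdV dW hdW hdV0 hdW0 ht hk 𝒦 h𝒦 (2 : ℂ) AW hAlaw hfinW hAcW FinfT hreadArch T₀ νinf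
      (K2LiuKindWArchCarrierUniform.νinf_eq_of_factorisation L e dV hdV dW hdW νN νv hνσ hνK νinf hmap)
      Tfr Tinv hTdef hTinvdef Aι Bι hAιdef hBιdef hMι hTι hTe hTe' FinfW hFinfW)
  exact ⟨A, U, hEuler, hAd, τ, NW, hτ, hdec, CW, κ, hCW, hκ, hsupp⟩

end Summit.HodgeConjecture.HodgeConjecture.Cruxes.HLiu418.K2LiuKindWBlockByName

end
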